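import Summits.QuantumFields.YangMills.Theorems.FluctuationComparisonRegPrIntLS2BetaWindowExactnessOfB8Thm2AtT3Members
import Summits.QuantumFields.YangMills.Theorems.FluctuationComparisonRegPrIntLS2BetaCriticalOrbitOfB8Thm2AtT3Members
import Summits.QuantumFields.YangMills.Theorems.FluctuationComparisonRegPrIntLS2BetaPosCollarOfB8Thm2AtT3Members
import Summits.QuantumFields.YangMills.Theorems.FluctuationComparisonRegPrIntLS2BetaSymmetriesLiftOfCritical
import Summits.QuantumFields.YangMills.Theorems.FluctuationComparisonRegPrIntLS2BetaGapFlatOrganOfLetters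
import Summits.QuantumFields.YangMills.Theorems.FluctuationComparisonRegPrIntLS2BetaArgminOrbitOfTower
import HarnessLib

/-!
# S2β · [Balaban1985Variational] THEOREM 1 — BOTH SENTENCES — AT EVERY BLOCK SIZE FROM THE ONE NAMED LITERATURE FACT `B8Thm2AtT3Members`;
# hence `hlift`, PROP. 7 CL. 1, REG-ARGMIN̄ ∕ ORB∘ ∕ REG-ARGMIN̄∘ and the v12-candidate organ GAP♭∘ FOR ALL `L` ⟸ the same name — the S2β organ road's trust base is 19200's

Cell `ym3-torus` (YM ladder rung R3 = continuum `SU(2)` Yang–Mills on the three-torus at fixed lattice data — a RUNG: NOT d = 4, NOT infinite volume, NOT a mass gap,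
NOT Clay).  Width seat `ym3-torus-px13` (gen 22), FILE B2 of the pen «the S2β organ road ⟸ one named Literature fact» (FILE A ✓`…S2BetaWindowExactnessOfB8Thm2AtT3Members`:
EXW∘ AS REGISTERED ⟸ the name; FILE B1 ✓`…S2BetaCriticalOrbitOfB8Thm2AtT3Members`: the critical-orbit letters; FILE C = px17 g17 ✓`…S2BetaPosCollarOfB8Thm2AtT3Members`: the
POS∘ letter); helper of the crux `stmt-QuantumFields-20520` (`…Theses.UnitScaleTilt.FluctuationComparisonRegPrIntL`), `--supports … --as helper`, count-neutral,
DEFINITION-FREE (0 `def`, 0 `instance`, 0 `notation`, 0 `sorry`, default heartbeats).  Registry v11.4 3732b7df untouched.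

WHAT (the `_five` theorems of ✓px13 g21 `…S2BetaSymmetriesLiftOfCritical` §2–§3 ∕ §5–§6 RE-THREADED — proofs VERBATIM, first `obtain` re-keyed — then compositions BY NAME).
* §1 ★★ `symmetriesLift_of_isCritR2_of_b8Thm2AtT3Members (hX) (L) (hL : 1 < L)` — the datum's symmetries lift to every R2-critical regular point (`hlift`), EVERY datum,
  EVERY block size, CONDITIONAL on `hX` (B1 `criticalRep_split_of_b8…` + the (1.29)-corner identity ✓`descTransf_eq_one_of_restrictedPrint_split`);
  ★★ `atMostOneCriticalOrbit_of_b8Thm2AtT3Members` — Prop. 7 cl. 1 at every datum (B1 `atMostOneCriticalOrbit_of_el_symmetriesLift_of_b8…` ∘ §1).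
* §2 `prop7AtMostOneCriticalOrbitAt_of_b8…`, `thm1UniqueMinOrbitAt_of_b8…` (the Literature schemas), ★★★ `thm1Pair_of_b8Thm2AtT3Members (hX) (L) (hL)` and
  ★★★ `thm1Pair_allL_of_b8Thm2AtT3Members (hX)` — **[Balaban1985Variational] THEOREM 1, BOTH SENTENCES (existence (8) in the global reading ∧ uniqueness of the minimal orbit in
  (6)), AT EVERY BLOCK SIZE, ⟸ `B8Thm2AtT3Members` ALONE** (sentence 1 = FILE A `thm1GlobalMinAt_of_b8…`).
* §3 consumers BY NAME: ★★ `argminRegularOrbit_of_b8Thm2AtT3Members` (REG-ARGMIN̄ + ORB∘ for all `L`, ✓px13 g21 `argminRegularOrbit_of_thm1Pair`);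
  ★★ `regArgminBarOrgan_of_b8Thm2AtT3Members` (REG-ARGMIN̄∘ for all `L`, ✓px17 g17 `regArgminBarOrganAt_of_thm1Pair`);
  ★★★ `gapFlatOrganAt_of_b8Thm2AtT3Members (hX) (L) (hL)` and ★★★ `gapFlatOrgan_of_b8Thm2AtT3Members (hX) : ∀ L, ⟨GAP♭∘-at-L⟩` — THE v12-CANDIDATE ORGAN (CERT 603780ac
  text) FOR ALL `L` ⟸ THE NAME (✓px17 g17 `gapFlatOrganAt_of_letters` ∕ `gapFlatOrgan_of_lettersAtThree` fed by px17's FILE C `posCollar_at_isCritR2_of_lift_of_b8…`, §1, §2).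
NET: under the docketed v12 re-key GAP♯∘ ↦ GAP♭∘, BOTH organ stubs 1–2 of LINE `semiclassical_s2beta` at ALL `L` have trust base {`B8Thm2AtT3Members`} — the trust base of
crux 19200 (✓`minimiserStabilityRegPr_of_b8Thm2AtT3Members`); the table's `L = 3` column is the debt item's one name.

HONEST SCOPE (CREDIT NOTHING): conditional plumbing, copied proofs, compositions by name; `B8Thm2AtT3Members` is OPEN exactly at `L = 3` (EMBARGO-LITE №58 honoured: `hX` is
a HYPOTHESIS, no Thm-2-at-3 proof attempted); at `L ≥ 5` every statement is already a hypothesis-free tree theorem; the REGISTERED `stub_uniformFibreGapOrbit` (v11.4, `∃ μ`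
before `∀ F γ J K V U₀`) is NOT this organ and NOT proved; DET-REP-B, H4ᶜ∘, LFR♯ᶜ∘, S2β, crux 20520, 19200, `YM3TorusSU2` NOT proved; no registered stub closed; rung R3 =
SU(2) YM₃ on T³ — NOT d = 4, NOT infinite volume, NOT a mass gap, NOT Clay; the Yang–Mills mass gap is NOT proved.  Sorry-free, axioms standard.

References: T. Bałaban, CMP **102** (1985) 277–309 [Balaban1985Variational] ((4)–(6) p.278, Thm 1 (8) p.279, Prop. 2 p.281, Prop. 7 p.299, Prop. 8 p.304, (141)–(143)
p.299); CMP **99** (1985) 75–102 [Balaban1985RegularSpaces] ((1.14) p.78, (1.19) p.79, (1.29) p.81, Thm 2 p.83); CMP **98** (1985) 17–51 [Balaban1985Averaging]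
((11)–(13) p.19, (78)–(81) p.30); CMP **102** (1985) 255–275 [Balaban1985UV3] ((7) p.257, (41) p.266).
-/

set_option autoImplicit false

noncomputable section

namespace Summit.QuantumFields.YangMills.Theorems.FluctuationComparisonRegPrIntLS2BetaThm1PairOfB8Thm2AtT3Members

open scoped BigOperators Matrix.Norms.L2Operator Matrix

open Literature.MathematicalPhysics.QuantumFieldTheory.Balaban1983to89
open Literature.MathematicalPhysics.QuantumFieldTheory.Balaban1983to89.T3ContinuumYM3Torus
open Literature.MathematicalPhysics.QuantumFieldTheory.Balaban1983to89.T3UnitLawDensityEML (ℰp)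
open Literature.MathematicalPhysics.QuantumFieldTheory.Balaban1983to89.T3UnitScaleTilt (histGood θBal)
open Literature.MathematicalPhysics.QuantumFieldTheory.Balaban1983to89.T3TiltDescent (descendTo)
open Literature.MathematicalPhysics.QuantumFieldTheory.Balaban1983to89.T3ConstrainedMinimiser (fibre)
open Literature.MathematicalPhysics.QuantumFieldTheory.Balaban1983to89.T3PrintedRegularMinimiser (RegPr regFibrePr mem_regFibrePr_iff minActionRegPr)
open Literature.MathematicalPhysics.QuantumFieldTheory.Balaban1983to89.T3PrintedRegularOrbits (descTransf liftTransfTo descTransf_liftTransfTo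
  gaugeAct_mem_regFibrePr_iff)
open Literature.MathematicalPhysics.QuantumFieldTheory.Balaban1983to89.T3Thm1Carrier (SameOrbit varProblem3)
open Literature.MathematicalPhysics.QuantumFieldTheory.Balaban1983to89.T3Thm1CarrierNative (IsCritR2)
open Literature.MathematicalPhysics.QuantumFieldTheory.Balaban1983to89.T3SectALandauChart (descTransf_mul descTransf_inv)
open Literature.MathematicalPhysics.QuantumFieldTheory.Balaban1983to89.T3UnitLawGaugeInvariance (gaugeAct_gaugeAct)
open Literature.MathematicalPhysics.QuantumFieldTheory.Balaban1983to89.T3Thm1UniquenessSchema (Thm1UniqueMinOrbitAt Prop7AtMostOneCriticalOrbitAt)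
open Literature.MathematicalPhysics.QuantumFieldTheory.Balaban1983to89.T3PrintedMinimiserExistence (Thm1GlobalMinAt)
open Literature.MathematicalPhysics.QuantumFieldTheory.Balaban1983to89.T3B8Thm2AtMembers (B8Thm2AtT3Members)
open T4Continuum
open Summit.QuantumFields.YangMills.Theorems.Prop7SPrint (IsAxialPrint RestrictedPrint)
open Summit.QuantumFields.YangMills.Theorems.Prop7TwistRegauge (descTransf_mul_inv_eq_one)
open Summit.QuantumFields.YangMills.Theorems.Prop7CritEL (deriv_comp_eq_zero_of_isCritR2 continuousAt_of_differentiableAt_bonds)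
open Summit.QuantumFields.YangMills.Theorems.Prop7OrbitTransport (isCritR2_gaugeAct)
open Summit.QuantumFields.YangMills.Theorems.AlphaInputsT3AC (thm1UniqueMinOrbitAt_of_prop7 thm1UniqueMinOrbitAt_mono)
open Summit.QuantumFields.YangMills.Theorems.FluctuationComparisonRegPrIntLS2BetaRestr129OfParallelSplit (descTransf_eq_one_of_restrictedPrint_split)
open Summit.QuantumFields.YangMills.Theorems.FluctuationComparisonRegPrIntLS2BetaWindowExactnessOfB8Thm2AtT3Members (thm1GlobalMinAt_of_b8Thm2AtT3Members)
open Summit.QuantumFields.YangMills.Theorems.FluctuationComparisonRegPrIntLS2BetaCriticalOrbitOfB8Thm2AtT3Members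
  (criticalRep_split_of_b8Thm2AtT3Members atMostOneCriticalOrbit_of_el_symmetriesLift_of_b8Thm2AtT3Members)
open Summit.QuantumFields.YangMills.Theorems.FluctuationComparisonRegPrIntLS2BetaPosCollarOfB8Thm2AtT3Members (posCollar_at_isCritR2_of_lift_of_b8Thm2AtT3Members)
open Summit.QuantumFields.YangMills.Theorems.FluctuationComparisonRegPrIntLS2BetaArgminOrbitOfTower (argminRegularOrbit_of_thm1Pair)
open Summit.QuantumFields.YangMills.Theorems.FluctuationComparisonRegPrIntLS2BetaGapFlatOrganFive (regArgminBarOrganAt_of_thm1Pair)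
open Summit.QuantumFields.YangMills.Theorems.FluctuationComparisonRegPrIntLS2BetaGapFlatOrganOfLetters (gapFlatOrganAt_of_letters gapFlatOrgan_of_lettersAtThree)

/-! ## §1 ★★ `hlift` and Prop. 7 cl. 1 at EVERY datum and EVERY block size from the name -/

/-- ★★ **THE DATUM's SYMMETRIES LIFT TO EVERY R2-CRITICAL REGULAR POINT — EVERY DATUM, EVERY BLOCK SIZE `L > 1`, CONDITIONAL ON THE ONE NAMED FACT** (`hlift`): the proof
of ✓px13 g21 `symmetriesLift_of_isCritR2_five` verbatim over FILE B1 `criticalRep_split_of_b8Thm2AtT3Members` — `κ := liftTransfTo s`, `W′ := κ • W` is R2-critical over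
`V` (✓`isCritR2_gaugeAct`), both E–L (Fermat), the split gives `v • W′ = u • W`, `k := u⁻¹·v·κ` fixes `W`, and `u↓ = 1` by the (1.29)-corner identity
(✓`descTransf_eq_one_of_restrictedPrint_split`), `v↓ = 1`, `κ↓ = s`.
[cite: Balaban1985Variational, (4)-(6) p.278, Prop. 7 p.299, Prop. 2 p.281; Balaban1985RegularSpaces, (1.29) p.81, (1.19) p.79, (1.14) p.78, Thm 2 p.83; Balaban1985Averaging, (11)-(13) p.19, (78)-(81) p.30] -/
theorem symmetriesLift_of_isCritR2_of_b8Thm2AtT3Members (hX : B8Thm2AtT3Members) (L : ℕ) (hL : 1 < L) :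
    ∃ e₈ : ℝ, 0 < e₈ ∧
      ∀ (F : T3Family), F.L = L → ∀ (n K : ℕ) (hnK : n < K) (e : ℝ) (V : GaugeField (F.P n) 0 (Matrix.specialUnitaryGroup (Fin 2) ℂ))
        (W : GaugeField (F.P K) 0 (Matrix.specialUnitaryGroup (Fin 2) ℂ)),
        0 < e → e ≤ e₈ → W ∈ regFibrePr F n K hnK.le e V → IsCritR2 F n K hnK.le V W →
        ∀ s : GaugeTransf (F.P n) 0 (Matrix.specialUnitaryGroup (Fin 2) ℂ), GaugeField.gaugeAct s V = V →
          ∃ k : GaugeTransf (F.P K) 0 (Matrix.specialUnitaryGroup (Fin 2) ℂ), GaugeField.gaugeAct k W = W ∧ descTransf F n K hnK.le k = s := by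
  obtain ⟨e₈, he₈, H⟩ := criticalRep_split_of_b8Thm2AtT3Members hX L hL
  refine ⟨e₈, he₈, ?_⟩
  intro F hF n K hnK e V W he hee hW hcrit s hs
  -- the lift `κ` of `s` and the moved critical point `W′ := κ • W` over the same datum
  set κ : GaugeTransf (F.P K) 0 (Matrix.specialUnitaryGroup (Fin 2) ℂ) := liftTransfTo F n K hnK.le s with hκdef
  have hκ : descTransf F n K hnK.le κ = s := descTransf_liftTransfTo F n K hnK.le s
  have hW' : GaugeField.gaugeAct κ W ∈ regFibrePr F n K hnK.le e V := by
    have h1 := (gaugeAct_mem_regFibrePr_iff F hnK.le he.le κ W V).2 hW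
    rwa [hκ, hs] at h1
  have hcrit' : IsCritR2 F n K hnK.le V (GaugeField.gaugeAct κ W) := by
    have h1 := isCritR2_gaugeAct F hnK.le κ hcrit
    rwa [hκ, hs] at h1
  have hELW : ∀ γ : ℝ → GaugeField (F.P K) 0 (Matrix.specialUnitaryGroup (Fin 2) ℂ), γ 0 = W → (∀ t, γ t ∈ fibre F ℰp n K hnK.le V) →
      (∀ b, DifferentiableAt ℝ (fun t => ((γ t b : Matrix.specialUnitaryGroup (Fin 2) ℂ) : Matrix (Fin 2) (Fin 2) ℂ)) 0) →
        deriv (fun t => wilsonAction4 (γ t)) 0 = 0 :=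
    fun γ hγ0 hγfib hγd => deriv_comp_eq_zero_of_isCritR2 hcrit γ hγ0 hγfib (continuousAt_of_differentiableAt_bonds γ hγd)
  have hELW' : ∀ γ : ℝ → GaugeField (F.P K) 0 (Matrix.specialUnitaryGroup (Fin 2) ℂ), γ 0 = GaugeField.gaugeAct κ W →
      (∀ t, γ t ∈ fibre F ℰp n K hnK.le V) →
      (∀ b, DifferentiableAt ℝ (fun t => ((γ t b : Matrix.specialUnitaryGroup (Fin 2) ℂ) : Matrix (Fin 2) (Fin 2) ℂ)) 0) →
        deriv (fun t => wilsonAction4 (γ t)) 0 = 0 :=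
    fun γ hγ0 hγfib hγd => deriv_comp_eq_zero_of_isCritR2 hcrit' γ hγ0 hγfib (continuousAt_of_differentiableAt_bonds γ hγd)
  obtain ⟨v, u, hv1, hrestr, hax, hvu⟩ := H F hF n K hnK e V W (GaugeField.gaugeAct κ W) he hee hW hELW hW' hELW'
  -- the stabiliser `k := u⁻¹·v·κ` of `W`, and `u = (v·κ)·k⁻¹`
  refine ⟨fun x => (u x)⁻¹ * (v x * κ x), ?_, ?_⟩
  · rw [← gaugeAct_gaugeAct, ← gaugeAct_gaugeAct, hvu, gaugeAct_gaugeAct]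
    have : (fun x => (u x)⁻¹ * u x) = fun _ => (1 : Matrix.specialUnitaryGroup (Fin 2) ℂ) := funext fun x => inv_mul_cancel _
    rw [this]
    funext b; simp [GaugeField.gaugeAct]
  · -- `u↓ = 1` by the (1.29)-corner identity, `v↓ = 1`, `κ↓ = s`
    have hk : GaugeField.gaugeAct (fun x => (u x)⁻¹ * (v x * κ x)) W = W := by
      rw [← gaugeAct_gaugeAct, ← gaugeAct_gaugeAct, hvu, gaugeAct_gaugeAct]
      have : (fun x => (u x)⁻¹ * u x) = fun _ => (1 : Matrix.specialUnitaryGroup (Fin 2) ℂ) := funext fun x => inv_mul_cancel _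
      rw [this]
      funext b; simp [GaugeField.gaugeAct]
    have hax' : IsAxialPrint F n K W (GaugeField.gaugeAct (fun x => v x * κ x) W) := by rw [← gaugeAct_gaugeAct]; exact hax
    have hu1 : descTransf F n K hnK.le u = fun _ => 1 :=
      descTransf_eq_one_of_restrictedPrint_split F hnK.le (p := fun x => v x * κ x) (k := fun x => (u x)⁻¹ * (v x * κ x))
        hrestr hax' hk (fun x => by group)
    have hv : descTransf F n K hnK.le v = fun _ => 1 := by
      have h1 := descTransf_mul_inv_eq_one F hnK.le (g := v) (u := fun _ => (1 : Matrix.specialUnitaryGroup (Fin 2) ℂ)) (fun y => by rw [hv1 y])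
      simpa using h1
    rw [descTransf_mul, descTransf_mul, descTransf_inv, hu1, hv, hκ]
    funext y; simp

/-- ★★ **[Balaban1985Variational] PROP. 7 CLAUSE 1 AT EVERY DATUM AND EVERY BLOCK SIZE `L > 1`, CONDITIONAL ON THE ONE NAMED FACT**: `∃ e₉ > 0` such that for every
member `F` (`F.L = L`), heights `n < K`, `0 < e ≤ e₉` and EVERY datum `V`, any two R2-critical configurations of print's regular space (6)(e) over `V` lie on one orbit of
print's group (4).  The proof of ✓px13 g21 `atMostOneCriticalOrbit_five` verbatim over FILE B1 and §1.
[cite: Balaban1985Variational, Prop. 7 p.299, Thm 1 p.279, (4)-(6) p.278, (141)-(143) p.299; Balaban1985RegularSpaces, Thm 2 p.83] -/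
theorem atMostOneCriticalOrbit_of_b8Thm2AtT3Members (hX : B8Thm2AtT3Members) (L : ℕ) (hL : 1 < L) :
    ∃ e₉ : ℝ, 0 < e₉ ∧
      ∀ (F : T3Family), F.L = L → ∀ (n K : ℕ) (hnK : n < K) (e : ℝ) (V : GaugeField (F.P n) 0 (Matrix.specialUnitaryGroup (Fin 2) ℂ)),
        0 < e → e ≤ e₉ → (varProblem3 F n K hnK.le).AtMostOneCriticalOrbit e V := by
  obtain ⟨e₈, he₈, H⟩ := atMostOneCriticalOrbit_of_el_symmetriesLift_of_b8Thm2AtT3Members hX L hL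
  obtain ⟨e₈', he₈', HL⟩ := symmetriesLift_of_isCritR2_of_b8Thm2AtT3Members hX L hL
  refine ⟨min e₈ e₈', lt_min he₈ he₈', ?_⟩
  intro F hF n K hnK e V he hee U U' hUreg hUfib hUcrit hU'reg hU'fib hU'crit
  have hU : U ∈ regFibrePr F n K hnK.le e V := (mem_regFibrePr_iff F).mpr ⟨hUfib, hUreg⟩
  have hELU : ∀ γ : ℝ → GaugeField (F.P K) 0 (Matrix.specialUnitaryGroup (Fin 2) ℂ), γ 0 = U → (∀ t, γ t ∈ fibre F ℰp n K hnK.le V) →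
      (∀ b, DifferentiableAt ℝ (fun t => ((γ t b : Matrix.specialUnitaryGroup (Fin 2) ℂ) : Matrix (Fin 2) (Fin 2) ℂ)) 0) →
        deriv (fun t => wilsonAction4 (γ t)) 0 = 0 :=
    fun γ hγ0 hγfib hγd => deriv_comp_eq_zero_of_isCritR2 hUcrit γ hγ0 hγfib (continuousAt_of_differentiableAt_bonds γ hγd)
  have hlift := HL F hF n K hnK e V U he (hee.trans (min_le_right _ _)) hU hUcrit
  exact H F hF n K hnK e V he (hee.trans (min_le_left _ _)) ⟨U, hU, hELU, hlift⟩ U U' hUreg hUfib hUcrit hU'reg hU'fib hU'crit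

/-! ## §2 ★★★ [Balaban1985Variational] THEOREM 1 — both sentences — at every block size from the name -/

/-- **PROP. 7 CLAUSE 1 AS TYPED IN THE LITERATURE SCHEMA, EVERY BLOCK SIZE `L > 1`, CONDITIONAL ON THE ONE NAMED FACT** (§1; the datum's smallness (7) is not used).
[cite: Balaban1985Variational, Prop. 7 p.299; Balaban1985RegularSpaces, Thm 2 p.83] -/
theorem prop7AtMostOneCriticalOrbitAt_of_b8Thm2AtT3Members (hX : B8Thm2AtT3Members) (L : ℕ) (hL : 1 < L) (B₃ : ℝ) (hB₃ : 0 < B₃) :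
    ∃ a₀ : ℝ, 0 < a₀ ∧ Prop7AtMostOneCriticalOrbitAt L a₀ B₃ := by
  obtain ⟨e₉, he₉, H⟩ := atMostOneCriticalOrbit_of_b8Thm2AtT3Members hX L hL
  refine ⟨e₉, he₉, fun F hF n K hnK ε₁ ε₀ hε₁ hlo hhi V _ => H F hF n K hnK ε₀ V ((mul_pos hB₃ hε₁).trans_le hlo) hhi⟩

/-- **[Balaban1985Variational] THM 1, SECOND SENTENCE (uniqueness of the minimal orbit in (6)), AS TYPED IN THE LITERATURE SCHEMA, EVERY BLOCK SIZE `L > 1`, CONDITIONAL ON THE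
ONE NAMED FACT** (✓`thm1UniqueMinOrbitAt_of_prop7` ∘ the previous theorem). [cite: Balaban1985Variational, Thm 1 (8) p.279, Prop. 7 p.299; Balaban1985RegularSpaces, Thm 2 p.83] -/
theorem thm1UniqueMinOrbitAt_of_b8Thm2AtT3Members (hX : B8Thm2AtT3Members) (L : ℕ) (hL : 1 < L) (B₃ : ℝ) (hB₃ : 0 < B₃) (a₁ : ℝ) :
    ∃ a₀ : ℝ, 0 < a₀ ∧ Thm1UniqueMinOrbitAt L a₀ a₁ B₃ := by
  obtain ⟨a₀, ha₀, h7⟩ := prop7AtMostOneCriticalOrbitAt_of_b8Thm2AtT3Members hX L hL B₃ hB₃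
  exact ⟨a₀, ha₀, thm1UniqueMinOrbitAt_of_prop7 hB₃ h7 a₁⟩

/-- ★★★ **[Balaban1985Variational] THEOREM 1, BOTH SENTENCES, AT EVERY BLOCK SIZE `L > 1`, CONDITIONAL ON THE ONE NAMED FACT `B8Thm2AtT3Members` — NOTHING ELSE**:
constants `a₀, a₁, B₃ > 0` with `Thm1GlobalMinAt L a₀ a₁ B₃` (sentence 1, (8), global reading — FILE A `thm1GlobalMinAt_of_b8Thm2AtT3Members`: the halving ✓`stub_halvingStep` +
EX from the name) AND `Thm1UniqueMinOrbitAt L a₀ a₁ B₃` (sentence 2 — this file, at the same `a₁, B₃`; both schemas antitone in `a₀`, so `a₀ := min`).  At `L ≥ 5` this is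
✓`thm1Pair_five` outright; the content of `hX` is used at `L = 3` only. [cite: Balaban1985Variational, Thm 1 (8) p.279, Prop. 7 p.299, Prop. 8 p.304; Balaban1985RegularSpaces, Thm 2 p.83] -/
theorem thm1Pair_of_b8Thm2AtT3Members (hX : B8Thm2AtT3Members) (L : ℕ) (hL : 1 < L) :
    ∃ a₀ a₁ B₃ : ℝ, 0 < a₀ ∧ 0 < a₁ ∧ 0 < B₃ ∧ Thm1GlobalMinAt L a₀ a₁ B₃ ∧ Thm1UniqueMinOrbitAt L a₀ a₁ B₃ := by
  obtain ⟨a₀, a₁, B₃, ha₀, ha₁, hB₃, hT⟩ := thm1GlobalMinAt_of_b8Thm2AtT3Members hX L hL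
  obtain ⟨a₀', ha₀', hU⟩ := thm1UniqueMinOrbitAt_of_b8Thm2AtT3Members hX L hL B₃ hB₃ a₁
  refine ⟨min a₀ a₀', a₁, B₃, lt_min ha₀ ha₀', ha₁, hB₃, ?_, thm1UniqueMinOrbitAt_mono hU (min_le_right _ _) le_rfl⟩
  intro F hF n K hnK ε₁ ε₀ hε₁ hε₁a hlo hhi V hV
  exact hT F hF n K hnK ε₁ ε₀ hε₁ hε₁a hlo (hhi.trans (min_le_left _ _)) V hV

/-- ★★★ **THE THM-1 PAIR FOR ALL ODD `L > 1`, CONDITIONAL ON THE ONE NAMED FACT** — the `hT` of ✓`argminRegularOrbit_of_thm1Pair` ∕ ✓`gapFlatOrganAt_of_letters` VERBATIM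
(today supplied by ✓`thm1Pair_allL_of_three` from an ANONYMOUS `L = 3` pair). [cite: Balaban1985Variational, Thm 1 p.279; Balaban1985RegularSpaces, Thm 2 p.83; Balaban1987RG1, §0 p.251] -/
theorem thm1Pair_allL_of_b8Thm2AtT3Members (hX : B8Thm2AtT3Members) :
    ∀ L : ℕ, Odd L → 1 < L → ∃ a₀ a₁ B₃ : ℝ, 0 < a₀ ∧ 0 < a₁ ∧ 0 < B₃ ∧ Thm1GlobalMinAt L a₀ a₁ B₃ ∧ Thm1UniqueMinOrbitAt L a₀ a₁ B₃ :=
  fun L _ hL => thm1Pair_of_b8Thm2AtT3Members hX L hL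

/-! ## §3 Consumers BY NAME: REG-ARGMIN̄ + ORB∘, REG-ARGMIN̄∘, and the v12-candidate organ GAP♭∘ for ALL `L` ⟸ the name -/

/-- ★★ **REG-ARGMIN̄ + ORB∘ FOR ALL `L` ⟸ THE ONE NAMED FACT** — ✓px13 g21 FILE D `argminRegularOrbit_of_thm1Pair` (the set-builder texts of ✓`argmin_eq_orbit_of_thm1Pair_of_regArgmin`,
its `hReg` deleted) fed by §2: on the interior window every good-history argmin of print's regular minimum is (6)-regular and the argmin set is ONE residual-gauge orbit.
[cite: Balaban1985Variational, Thm 1 (8) p.279, Prop. 7 p.299, (4)-(6) p.278; Balaban1985RegularSpaces, Thm 2 p.83; Balaban1985UV3, (7) p.257, (41) p.266] -/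
theorem argminRegularOrbit_of_b8Thm2AtT3Members (hX : B8Thm2AtT3Members) :
    ∀ (L : ℕ), ∃ c₀ : ℝ, 0 < c₀ ∧ c₀ ≤ 1 ∧ ∀ (cw : ℝ), 0 < cw → cw ≤ c₀ → ∃ pS : ℝ, ∀ (b₀ p₀ : ℝ), 0 < b₀ → pS ≤ p₀ → 0 < p₀ →
      ∃ ε₁ : ℝ, 0 < ε₁ ∧ ∀ (ε₀ : ℝ), 0 < ε₀ → ε₀ ≤ ε₁ →
      ∃ γ₁ : ℝ, 0 < γ₁ ∧ ∀ (F : T3Family) (γ : ℝ), F.L = L → 0 < γ → γ ≤ γ₁ →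
        ∀ (J K : ℕ) (hJK : J ≤ K) (V : GaugeField (F.P J) 0 (Matrix.specialUnitaryGroup (Fin 2) ℂ)), PlaqSmall (θBal F.L γ (cw * b₀) p₀ J) V →
          (∀ U' ∈ {U' | U' ∈ fibre F ℰp J K hJK V ∧ U' ∈ histGood F ℰp (θBal F.L γ b₀ p₀) K J ∧
              wilsonAction4 U' = minActionRegPr F J K hJK ε₀ V}, RegPr F J K ε₀ U') ∧
          ∀ U₀ ∈ {U' | U' ∈ fibre F ℰp J K hJK V ∧ U' ∈ histGood F ℰp (θBal F.L γ b₀ p₀) K J ∧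
              wilsonAction4 U' = minActionRegPr F J K hJK ε₀ V},
            {U' | U' ∈ fibre F ℰp J K hJK V ∧ U' ∈ histGood F ℰp (θBal F.L γ b₀ p₀) K J ∧
              wilsonAction4 U' = minActionRegPr F J K hJK ε₀ V} =
              {U | ∃ w : Site (F.P K) 0 → Matrix.specialUnitaryGroup (Fin 2) ℂ,
                (∀ U' : GaugeField (F.P K) 0 (Matrix.specialUnitaryGroup (Fin 2) ℂ),
                    descendTo F ℰp J K hJK (GaugeField.gaugeAct w U') = descendTo F ℰp J K hJK U') ∧
                  U = GaugeField.gaugeAct w U₀} :=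
  argminRegularOrbit_of_thm1Pair (thm1Pair_allL_of_b8Thm2AtT3Members hX)

/-- ★★ **REG-ARGMIN̄∘ AT EVERY BLOCK SIZE `L > 1` ⟸ THE ONE NAMED FACT** («closed-window achievers are (6)-regular»; ✓px17 g17 `regArgminBarOrganAt_of_thm1Pair` fed by §2 — the
letter EQUIVALENT by kernel to GAP♭∘-at-`L`, ✓`…S2BetaGapFlatOrganOfRegArgminBar`). [cite: Balaban1985Variational, Thm 1 (8) p.279, Prop. 7 p.299; Balaban1985RegularSpaces, Thm 2 p.83; Balaban1985UV3, (7) p.257] -/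
theorem regArgminBarOrganAt_of_b8Thm2AtT3Members (hX : B8Thm2AtT3Members) (L : ℕ) (hL : 1 < L) :
    ∃ c₀ : ℝ, 0 < c₀ ∧ c₀ ≤ 1 ∧ ∀ (cw : ℝ), 0 < cw → cw ≤ c₀ → ∃ pS : ℝ, ∀ (b₀ p₀ : ℝ), 0 < b₀ → pS ≤ p₀ → 0 < p₀ →
      ∃ ε₁ : ℝ, 0 < ε₁ ∧ ∀ (ε₀ : ℝ), 0 < ε₀ → ε₀ ≤ ε₁ →
      ∃ γ₁ : ℝ, 0 < γ₁ ∧ ∀ (F : T3Family) (γ : ℝ), F.L = L → 0 < γ → γ ≤ γ₁ →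
        ∀ (J K : ℕ) (hJK : J ≤ K) (V : GaugeField (F.P J) 0 (Matrix.specialUnitaryGroup (Fin 2) ℂ)), PlaqSmall (θBal F.L γ (cw * b₀) p₀ J) V →
          ∀ U ∈ closure (fibre F ℰp J K hJK V ∩ histGood F ℰp (θBal F.L γ b₀ p₀) K J),
            wilsonAction4 U ≤ minActionRegPr F J K hJK ε₀ V → RegPr F J K ε₀ U := by
  obtain ⟨a₀, a₁, B₃, ha₀, ha₁, hB₃, hT, hU1⟩ := thm1Pair_of_b8Thm2AtT3Members hX L hL
  exact regArgminBarOrganAt_of_thm1Pair hL ha₀ ha₁ hB₃ hT hU1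

/-- ★★★ **THE v12-CANDIDATE ORGAN GAP♭∘ AT EVERY BLOCK SIZE `L > 1` ⟸ THE ONE NAMED FACT** (CERT 603780ac text at `L`: `∃ μ > 0` AFTER the base point): ✓px17 g17
`gapFlatOrganAt_of_letters` fed by the four letters at `L` from the name — POS∘ (px17 g17 FILE C `posCollar_at_isCritR2_of_lift_of_b8Thm2AtT3Members`), `hlift` (§1),
Prop. 7 cl. 1 (§1), the Thm-1 pair (§2). [cite: Balaban1985Variational, (142) p.299, Prop. 7 p.299, Thm 1 (8)-(10) p.279, (4)-(6) p.278; Balaban1985RegularSpaces, Thm 2 p.83; Balaban1985UV3, (7) p.257] -/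
theorem gapFlatOrganAt_of_b8Thm2AtT3Members (hX : B8Thm2AtT3Members) (L : ℕ) (hL : 1 < L) :
    ∃ c₀ : ℝ, 0 < c₀ ∧ c₀ ≤ 1 ∧ ∀ (cw : ℝ), 0 < cw → cw ≤ c₀ → ∃ pS : ℝ, ∀ (b₀ p₀ : ℝ), 0 < b₀ → pS ≤ p₀ → 0 < p₀ →
      ∃ ε₁ : ℝ, 0 < ε₁ ∧ ∀ (ε₀ : ℝ), 0 < ε₀ → ε₀ ≤ ε₁ →
      ∃ γ₁ : ℝ, 0 < γ₁ ∧ ∀ (F : T3Family) (γ : ℝ), F.L = L → 0 < γ → γ ≤ γ₁ →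
        ∀ (J K : ℕ) (hJK : J ≤ K) (V : GaugeField (F.P J) 0 (Matrix.specialUnitaryGroup (Fin 2) ℂ)), PlaqSmall (θBal F.L γ (cw * b₀) p₀ J) V →
          ∀ U₀ ∈ {U' | U' ∈ fibre F ℰp J K hJK V ∧ U' ∈ histGood F ℰp (θBal F.L γ b₀ p₀) K J ∧
              wilsonAction4 U' = minActionRegPr F J K hJK ε₀ V}, ∃ μ : ℝ, 0 < μ ∧
            ∀ U ∈ fibre F ℰp J K hJK V, U ∈ histGood F ℰp (θBal F.L γ b₀ p₀) K J →
              μ * ((F.L : ℝ)⁻¹) ^ (2 * (K - J)) *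
                  (⨅ w : {w : Site (F.P K) 0 → Matrix.specialUnitaryGroup (Fin 2) ℂ |
                      ∀ U : GaugeField (F.P K) 0 (Matrix.specialUnitaryGroup (Fin 2) ℂ),
                        descendTo F ℰp J K hJK (GaugeField.gaugeAct w U) = descendTo F ℰp J K hJK U},
                    ∑ ℓ : PBond (F.P K) 0,
                      dist1 (U ℓ * ((GaugeField.gaugeAct (w : Site (F.P K) 0 → Matrix.specialUnitaryGroup (Fin 2) ℂ) U₀) ℓ)⁻¹) ^ 2)
                ≤ wilsonAction4 U - minActionRegPr F J K hJK ε₀ V :=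
  gapFlatOrganAt_of_letters hL (posCollar_at_isCritR2_of_lift_of_b8Thm2AtT3Members hX L hL)
    (symmetriesLift_of_isCritR2_of_b8Thm2AtT3Members hX L hL) (atMostOneCriticalOrbit_of_b8Thm2AtT3Members hX L hL) (thm1Pair_of_b8Thm2AtT3Members hX L hL)

/-- ★★★ **THE v12-CANDIDATE ORGAN GAP♭∘ FOR ALL `L` (CERT 603780ac `def UniformFibreGapOrbit` body VERBATIM, `∀ L`) ⟸ THE ONE NAMED FACT `B8Thm2AtT3Members` — NOTHING ELSE**:
✓px17 g17 `gapFlatOrgan_of_lettersAtThree` fed by the four `L = 3` letters from the name (`L ≥ 5` is ✓`gapFlatOrganAt_five` outright inside the door; even `L` vacuous).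
With FILE A `windowExactness_of_b8Thm2AtT3Members`: under the docketed v12 re-key, BOTH organ stubs 1–2 of LINE `semiclassical_s2beta` at ALL `L` have trust base
{`B8Thm2AtT3Members`} = crux 19200's. [cite: Balaban1985Variational, (142) p.299, Prop. 7 p.299, Thm 1 (8)-(10) p.279; Balaban1985RegularSpaces, Thm 2 p.83; Balaban1985UV3, (7) p.257, (41) p.266] -/
theorem gapFlatOrgan_of_b8Thm2AtT3Members (hX : B8Thm2AtT3Members) :
    ∀ (L : ℕ), ∃ c₀ : ℝ, 0 < c₀ ∧ c₀ ≤ 1 ∧ ∀ (cw : ℝ), 0 < cw → cw ≤ c₀ → ∃ pS : ℝ, ∀ (b₀ p₀ : ℝ), 0 < b₀ → pS ≤ p₀ → 0 < p₀ →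
      ∃ ε₁ : ℝ, 0 < ε₁ ∧ ∀ (ε₀ : ℝ), 0 < ε₀ → ε₀ ≤ ε₁ →
      ∃ γ₁ : ℝ, 0 < γ₁ ∧ ∀ (F : T3Family) (γ : ℝ), F.L = L → 0 < γ → γ ≤ γ₁ →
        ∀ (J K : ℕ) (hJK : J ≤ K) (V : GaugeField (F.P J) 0 (Matrix.specialUnitaryGroup (Fin 2) ℂ)), PlaqSmall (θBal F.L γ (cw * b₀) p₀ J) V →
          ∀ U₀ ∈ {U' | U' ∈ fibre F ℰp J K hJK V ∧ U' ∈ histGood F ℰp (θBal F.L γ b₀ p₀) K J ∧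
              wilsonAction4 U' = minActionRegPr F J K hJK ε₀ V}, ∃ μ : ℝ, 0 < μ ∧
            ∀ U ∈ fibre F ℰp J K hJK V, U ∈ histGood F ℰp (θBal F.L γ b₀ p₀) K J →
              μ * ((F.L : ℝ)⁻¹) ^ (2 * (K - J)) *
                  (⨅ w : {w : Site (F.P K) 0 → Matrix.specialUnitaryGroup (Fin 2) ℂ |
                      ∀ U : GaugeField (F.P K) 0 (Matrix.specialUnitaryGroup (Fin 2) ℂ),
                        descendTo F ℰp J K hJK (GaugeField.gaugeAct w U) = descendTo F ℰp J K hJK U},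
                    ∑ ℓ : PBond (F.P K) 0,
                      dist1 (U ℓ * ((GaugeField.gaugeAct (w : Site (F.P K) 0 → Matrix.specialUnitaryGroup (Fin 2) ℂ) U₀) ℓ)⁻¹) ^ 2)
                ≤ wilsonAction4 U - minActionRegPr F J K hJK ε₀ V :=
  gapFlatOrgan_of_lettersAtThree (posCollar_at_isCritR2_of_lift_of_b8Thm2AtT3Members hX 3 (by norm_num))
    (symmetriesLift_of_isCritR2_of_b8Thm2AtT3Members hX 3 (by norm_num)) (atMostOneCriticalOrbit_of_b8Thm2AtT3Members hX 3 (by norm_num))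
    (thm1Pair_of_b8Thm2AtT3Members hX 3 (by norm_num))

end Summit.QuantumFields.YangMills.Theorems.FluctuationComparisonRegPrIntLS2BetaThm1PairOfB8Thm2AtT3Members

end
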